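import Summits.CriticalPhenomena.SAWScalingLimit.Theses.SAWConePseudogroup
import Summits.CriticalPhenomena.SAWScalingLimit.Theses.SAWConfRestriction
import Summits.CriticalPhenomena.SAWScalingLimit.Theses.SAWBrownianDomination
import Summits.CriticalPhenomena.SAWScalingLimit.Theses.SAWTowerCount
import Summits.CriticalPhenomena.SAWScalingLimit.Theses.SAWTensorRG
import Summits.CriticalPhenomena.SAWScalingLimit.Theses.SAWExpCovariance
import Summits.CriticalPhenomena.SAWScalingLimit.Theorems.SAWTensorRGRestrictionOfLimitStubRestrictionOfSqueeze
import Summits.CriticalPhenomena.SAWScalingLimit.Theorems.SAWTensorRGRestrictionOfLimitStubRadoSqueezeFamily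
import Literature.Probability.RandomPlanarGeometry.CovariantSqueezeContinuity
import Literature.Probability.RandomPlanarGeometry.ConformalMapCaratheodoryProofs

/-!
# `RestrictionOfLimit` from Radó continuity of the scaling limit (`ContinuityOfLimit`, stmt-CriticalPhenomena-7305)

Support file (`--supports stmt-CriticalPhenomena-0773`, registered stub `stub_restrictionOfLimitOfContinuityOfLimit`,
composition 5 of the skeleton `Cruxes/RestrictionOfLimit/Lines/birth.lean`) of the line `birth` for the crux
`RestrictionOfLimit` (stmt-CriticalPhenomena-0773; shared verbatim by the routes SAWConePseudogroup r7 /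
SAWConfRestriction r4 / SAWBrownianDomination r5 / SAWTowerCount support / SAWTensorRG r5).

**Headline.** `ContinuityOfLimit → RestrictionOfLimit` (both in their SAWConePseudogroup copies, r4 ⇒ r7 of that route):
if the scaling limit `P` of the critical square-lattice SAW is RADÓ-CONTINUOUS in the domain (`ChordalFamily.IsRadoContinuous`:
`Φ_n → Φ` uniformly on `closure B`, each complex differentiable on `B` and injective on `closure B` ⇒ `P (Φ_n B) ⇒ P (Φ B)`
weakly), then `P` has Lawler–Schramm–Werner's two-sided restriction property for EVERY pair of Dobrushin domains
`D' ⊆ D` with the same marked points. Radó continuity is strictly weaker than conformal covariance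
(`IsConformallyCovariant.isRadoContinuous_of_isChordal`, `RadoContinuity.lean`) and is what route SAWConePseudogroup
wants to extract from the lattice BEFORE conformal invariance; so this bridge places the crux `RestrictionOfLimit`
below `ContinuityOfLimit` (stmt-7305), hence below `ConfCovLimit` (stmt-0771), and — through
`discContinuity_of_continuityOfLimit` — records `ContinuityOfLimit → DiscContinuity` (stmt-7305 ⇒ stmt-6755) as well.

**Proof.** The earlier leads LANDED, in this namespace, the glue `stub_restrictionOfSqueeze` (p154640: the identity holds
along any separated exhausting outer squeeze `E t ↓ D'` with `P (E t) ⇒ P D'`) and the geometry `stub_radoSqueezeFamily`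
(p167791: every pair has such a squeeze with closed-disc uniformizers `Φ t → Φ` uniformly on the closed unit disc,
`Φ t`, `Φ` continuous on `ℂ` and agreeing on the OPEN disc with conformal equivalences onto `E t`, `D'`). To feed
`IsRadoContinuous` two things are added here:
* INJECTIVITY ON THE CLOSED DISC (`injOn_closedBall_of_eqOn_conformalEquiv`): a continuous `Ψ : ℂ → ℂ` agreeing on the
  open unit disc with a conformal equivalence onto a JORDAN domain is injective on the closed disc — by Carathéodory's
  theorem (`JordanDomain.exists_continuousOn_extension_holds`, PROVED in the tree: the equivalence extends to a
  continuous bijection of the closed disc onto the closed domain) and uniqueness of continuous extensions from the dense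
  open disc (`Set.EqOn.of_subset_closure`);
* SEQUENTIALISATION of the filter `𝓝[>] 0` (`Filter.tendsto_iff_seq_tendsto`; a sequence tending to `0⁺` is made
  positive on its finitely many non-positive terms), as in `tendsto_integral_of_discContinuity` (p168098).
The parameter domain is a Dobrushin structure `B` on the unit disc marked at `-1, 1`
(`DobrushinDomain.exists_carrier_eq_ball_pt_eq`, `CovariantSqueezeContinuity.lean`).

References: G. F. Lawler, O. Schramm, W. Werner, *On the scaling limit of planar self-avoiding walk*, Proc. Sympos. Pure
Math. 72 (2004), arXiv:math/0204277, §3.4.5; Ch. Pommerenke, *Boundary Behaviour of Conformal Maps* (1992), Thm. 2.6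
(Carathéodory) and §2.3 Thm. 2.11 (Radó). No named fact is used; axioms `propext`, `Classical.choice`, `Quot.sound`.
-/

noncomputable section

open MeasureTheory Filter Topology Set Metric
open scoped ENNReal NNReal BoundedContinuousFunction
open Literature.Probability.RandomPlanarGeometry Literature.Probability.LatticeModels

namespace Summit.CriticalPhenomena.SAWScalingLimit.Theorems.RestrictionOfLimit.Birth

/-! ### Carathéodory: closed-disc uniformizers of Jordan domains are injective on the closed disc -/

/-- **Injectivity on the closed disc.** If `Ψ : ℂ → ℂ` is continuous and agrees on the open unit disc with a conformal
equivalence `g` of the disc onto (the carrier of) a Dobrushin — in particular Jordan — domain `E`, then `Ψ` is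
injective on the CLOSED unit disc: Carathéodory's theorem gives a continuous extension `Φ'` of `g` to the closed disc
which is a bijection onto `closure E`; `Ψ = Φ'` on the closed disc because both are continuous there and agree on the
dense open disc. [cite: PommerenkeBBCM1992, Thm. 2.6] -/
theorem injOn_closedBall_of_eqOn_conformalEquiv {E : DobrushinDomain} (Ψ : C(ℂ, ℂ))
    (g : ConformalEquiv (Metric.ball (0 : ℂ) 1) E.carrier) (hΨ : EqOn Ψ g (Metric.ball (0 : ℂ) 1)) :
    InjOn Ψ (Metric.closedBall (0 : ℂ) 1) := by
  obtain ⟨Φ', hcont, heq, hbij, -⟩ := JordanDomain.exists_continuousOn_extension_holds E.toJordanDomain g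
  have h1 : EqOn Ψ Φ' (Metric.ball (0 : ℂ) 1) := fun z hz => (hΨ hz).trans (heq hz).symm
  have h2 : EqOn Ψ Φ' (Metric.closedBall (0 : ℂ) 1) :=
    h1.of_subset_closure Ψ.continuous.continuousOn hcont ball_subset_closedBall
      (by rw [closure_ball (0 : ℂ) one_ne_zero])
  exact h2.injOn_iff.2 hbij.injOn

/-! ### Radó continuity ⇒ weak continuity along a Radó squeeze -/

/-- **Radó continuity along a sequence of closed-disc uniformizers.** If `P` is Radó-continuous and `Φ_n → Φ`
uniformly on the closed unit disc, where `Φ_n`, `Φ : ℂ → ℂ` are continuous and agree on the open disc with conformal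
equivalences onto Dobrushin domains `D_n`, `D'` whose marked points are `Φ_n (∓1)`, `Φ (∓1)`, then
`∫ f dP(D_n) → ∫ f dP(D')` — the hypothesis shape of `DiscContinuity` (stmt-CriticalPhenomena-6755). The parameter
domain is a Dobrushin structure on the unit disc marked at `-1, 1`; differentiability / injectivity on the open disc
and the carrier and mark clauses come from the equivalences (`image_data_of_conformalEquiv_ball`), injectivity on the
closed disc from Carathéodory (`injOn_closedBall_of_eqOn_conformalEquiv`). [folklore] -/
theorem tendsto_integral_of_isRadoContinuous_seq {P : ChordalFamily} (hR : P.IsRadoContinuous)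
    {Dn : ℕ → DobrushinDomain} {D' : DobrushinDomain} {Φn : ℕ → C(ℂ, ℂ)} {Φ : C(ℂ, ℂ)}
    (hΦn : ∀ n, ∃ g : ConformalEquiv (Metric.ball (0 : ℂ) 1) (Dn n).carrier,
      EqOn (Φn n) g (Metric.ball (0 : ℂ) 1))
    (hΦ : ∃ g : ConformalEquiv (Metric.ball (0 : ℂ) 1) D'.carrier, EqOn Φ g (Metric.ball (0 : ℂ) 1))
    (hmk : ∀ n, (Dn n).pt 0 = Φn n (-1) ∧ (Dn n).pt 1 = Φn n 1) (h0 : D'.pt 0 = Φ (-1)) (h1 : D'.pt 1 = Φ 1)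
    (hunif : TendstoUniformlyOn (fun n => ((Φn n : C(ℂ, ℂ)) : ℂ → ℂ)) (Φ : ℂ → ℂ) atTop
      (Metric.closedBall (0 : ℂ) 1))
    (f : CurveClass ℂ →ᵇ ℝ) :
    Tendsto (fun n => ∫ γ, f γ ∂(P (Dn n))) atTop (𝓝 (∫ γ, f γ ∂(P D'))) := by
  obtain ⟨B, hB, hB0, hB1⟩ := DobrushinDomain.exists_carrier_eq_ball_pt_eq
  obtain ⟨g, hg⟩ := hΦ
  obtain ⟨hd, hi, hc, h0', h1'⟩ := ChordalFamily.image_data_of_conformalEquiv_ball hB hB0 hB1 g hg h0 h1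
  have hcl : closure B.carrier = Metric.closedBall (0 : ℂ) 1 := by rw [hB, closure_ball (0 : ℂ) one_ne_zero]
  have hiC : InjOn Φ (closure B.carrier) := by
    rw [hcl]
    exact injOn_closedBall_of_eqOn_conformalEquiv Φ g hg
  choose gn hgn using hΦn
  have hdata : ∀ n, DifferentiableOn ℂ (Φn n) B.carrier ∧ InjOn (Φn n) (closure B.carrier) := fun n => by
    obtain ⟨hdn, -, -, -, -⟩ :=
      ChordalFamily.image_data_of_conformalEquiv_ball hB hB0 hB1 (gn n) (hgn n) (hmk n).1 (hmk n).2
    refine ⟨hdn, ?_⟩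
    rw [hcl]
    exact injOn_closedBall_of_eqOn_conformalEquiv (Φn n) (gn n) (hgn n)
  have hDn : ∀ n, (Dn n).carrier = Φn n '' B.carrier ∧ (Dn n).pt 0 = Φn n (B.pt 0) ∧
      (Dn n).pt 1 = Φn n (B.pt 1) := fun n => by
    obtain ⟨-, -, hcn, h0n, h1n⟩ :=
      ChordalFamily.image_data_of_conformalEquiv_ball hB hB0 hB1 (gn n) (hgn n) (hmk n).1 (hmk n).2
    exact ⟨hcn, h0n, h1n⟩
  have hunif' : TendstoUniformlyOn (fun n => ((Φn n : C(ℂ, ℂ)) : ℂ → ℂ)) (Φ : ℂ → ℂ) atTop (closure B.carrier) := by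
    rw [hcl]
    exact hunif
  exact hR B D' Dn Φ Φn hunif' hd hiC hdata hc h0' h1' hDn f

/-- **Radó continuity along a Radó squeeze** (filter `t → 0⁺`): if `P` is Radó-continuous, then along closed-disc
uniformizers `Φ t → Φ` converging uniformly on the closed disc as `t → 0⁺` (the data of `stub_radoSqueezeFamily`) the
laws `P (E t)` converge weakly to `P D'`. Sequential characterisation of the limit along the countably generated filter
`𝓝[>] 0`; the sequence is made positive on its finitely many non-positive terms. [folklore] -/
theorem tendsto_integral_of_isRadoContinuous {P : ChordalFamily} (hR : P.IsRadoContinuous)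
    {D' : DobrushinDomain} {E : ℝ → DobrushinDomain} {Φt : ℝ → C(ℂ, ℂ)} {Φ : C(ℂ, ℂ)}
    (hΦt : ∀ t : ℝ, 0 < t → ∃ g : ConformalEquiv (Metric.ball (0 : ℂ) 1) (E t).carrier,
      EqOn (Φt t) g (Metric.ball (0 : ℂ) 1))
    (hΦ : ∃ g : ConformalEquiv (Metric.ball (0 : ℂ) 1) D'.carrier, EqOn Φ g (Metric.ball (0 : ℂ) 1))
    (hmk : ∀ t : ℝ, 0 < t → (E t).pt 0 = Φt t (-1) ∧ (E t).pt 1 = Φt t 1)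
    (h0 : D'.pt 0 = Φ (-1)) (h1 : D'.pt 1 = Φ 1)
    (hunif : TendstoUniformlyOn (fun t => ((Φt t : C(ℂ, ℂ)) : ℂ → ℂ)) (Φ : ℂ → ℂ) (𝓝[>] (0 : ℝ))
      (Metric.closedBall (0 : ℂ) 1))
    (f : CurveClass ℂ →ᵇ ℝ) :
    Tendsto (fun t : ℝ => ∫ γ, f γ ∂(P (E t))) (𝓝[>] (0 : ℝ)) (𝓝 (∫ γ, f γ ∂(P D'))) := by
  rw [Filter.tendsto_iff_seq_tendsto]
  intro u hu
  -- the sequence is eventually positive; make it positive everywhere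
  have hu_pos : ∀ᶠ n in atTop, 0 < u n :=
    (hu.eventually (eventually_mem_nhdsWithin (a := (0 : ℝ)) (s := Ioi 0))).mono fun n hn => hn
  set u' : ℕ → ℝ := fun n => if 0 < u n then u n else 1 with hu'_def
  have hu'_pos : ∀ n, 0 < u' n := fun n => by
    simp only [hu'_def]
    split_ifs with h
    · exact h
    · exact one_pos
  have hu'_eq : ∀ᶠ n in atTop, u' n = u n := hu_pos.mono fun n hn => by simp [hu'_def, hn]
  have hu' : Tendsto u' atTop (𝓝[>] (0 : ℝ)) := hu.congr' (hu'_eq.mono fun n hn => hn.symm)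
  have hunif' : TendstoUniformlyOn (fun n => ((Φt (u' n) : C(ℂ, ℂ)) : ℂ → ℂ)) (Φ : ℂ → ℂ) atTop
      (Metric.closedBall (0 : ℂ) 1) := by
    rw [Metric.tendstoUniformlyOn_iff] at hunif ⊢
    intro ε hε
    exact hu'.eventually (hunif ε hε)
  have key := tendsto_integral_of_isRadoContinuous_seq hR (Dn := fun n => E (u' n)) (Φn := fun n => Φt (u' n))
    (fun n => hΦt (u' n) (hu'_pos n)) hΦ (fun n => hmk (u' n) (hu'_pos n)) h0 h1 hunif' f
  refine key.congr' (hu'_eq.mono fun n hn => ?_)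
  simp only [Function.comp_apply, hn]

/-! ### Radó continuity ⇒ restriction, for the SAW scaling limit -/

/-- **A Radó-continuous SAW scaling limit has the two-sided restriction property** for every pair of Dobrushin domains
`D' ⊆ D` with the same marked points: the Radó squeeze of `(D, D')` (`stub_radoSqueezeFamily`), weak continuity along
it (`tendsto_integral_of_isRadoContinuous`), and the glue `stub_restrictionOfSqueeze`.
[cite: LawlerSchrammWerner2004SAW, §3.4.5] -/
theorem isRestriction_of_isRadoContinuous {P : ChordalFamily} (hP : SAW.IsScalingLimitFamily P)
    (hR : P.IsRadoContinuous) : P.IsRestriction := by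
  intro D D' hsub h0 h1 T hTm
  obtain ⟨E, hN, hS, hX, Φt, Φ, hΦt, hΦ, hmk, h0', h1', hunif⟩ := stub_radoSqueezeFamily D D' hsub h0 h1
  exact stub_restrictionOfSqueeze P hP D D' E hN hS hX
    (fun f => tendsto_integral_of_isRadoContinuous hR hΦt hΦ hmk h0' h1' hunif f) T hTm

/-! ### Registered stub: `ContinuityOfLimit → RestrictionOfLimit` (composition 5 of the skeleton) -/

/-- **Registered stub `stub_restrictionOfLimitOfContinuityOfLimit` — `ContinuityOfLimit → RestrictionOfLimit`** (both in
their SAWConePseudogroup copies, r4 ⇒ r7 of that route): Radó continuity of the SAW scaling limit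
(stmt-CriticalPhenomena-7305) implies LSW's restriction property for every pair `D' ⊆ D` with the same marked points
(stmt-CriticalPhenomena-0773). `ContinuityOfLimit` is literally `∀ P, IsChordal P → (lim) P → P.IsRadoContinuous`.
A CONDITIONAL result; its point is that r7 is implied by r4 inside the route. [cite: LawlerSchrammWerner2004SAW, §3.4.5] -/
theorem stub_restrictionOfLimitOfContinuityOfLimit :
    Summit.CriticalPhenomena.SAWScalingLimit.Theses.SAWConePseudogroup.ContinuityOfLimit →
      Summit.CriticalPhenomena.SAWScalingLimit.Theses.SAWConePseudogroup.RestrictionOfLimit := by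
  intro hCont P hch hlim D D' hsub h0 h1 T hTm
  exact isRestriction_of_isRadoContinuous ⟨hch, hlim⟩ (hCont P hch hlim) D D' hsub h0 h1 T hTm

/-- `ContinuityOfLimit → RestrictionOfLimit`, SAWConfRestriction copy of the conclusion. [folklore] -/
theorem restrictionOfLimit_confRestriction_of_continuityOfLimit
    (h : Summit.CriticalPhenomena.SAWScalingLimit.Theses.SAWConePseudogroup.ContinuityOfLimit) :
    Summit.CriticalPhenomena.SAWScalingLimit.Theses.SAWConfRestriction.RestrictionOfLimit :=
  stub_restrictionOfLimitOfContinuityOfLimit h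

/-- `ContinuityOfLimit → RestrictionOfLimit`, SAWBrownianDomination copy of the conclusion. [folklore] -/
theorem restrictionOfLimit_brownianDomination_of_continuityOfLimit
    (h : Summit.CriticalPhenomena.SAWScalingLimit.Theses.SAWConePseudogroup.ContinuityOfLimit) :
    Summit.CriticalPhenomena.SAWScalingLimit.Theses.SAWBrownianDomination.RestrictionOfLimit :=
  stub_restrictionOfLimitOfContinuityOfLimit h

/-- `ContinuityOfLimit → RestrictionOfLimit`, SAWTowerCount copy of the conclusion. [folklore] -/
theorem restrictionOfLimit_towerCount_of_continuityOfLimit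
    (h : Summit.CriticalPhenomena.SAWScalingLimit.Theses.SAWConePseudogroup.ContinuityOfLimit) :
    Summit.CriticalPhenomena.SAWScalingLimit.Theses.SAWTowerCount.RestrictionOfLimit :=
  stub_restrictionOfLimitOfContinuityOfLimit h

/-- `ContinuityOfLimit → RestrictionOfLimit`, SAWTensorRG copy of the conclusion. [folklore] -/
theorem restrictionOfLimit_tensorRG_of_continuityOfLimit
    (h : Summit.CriticalPhenomena.SAWScalingLimit.Theses.SAWConePseudogroup.ContinuityOfLimit) :
    Summit.CriticalPhenomena.SAWScalingLimit.Theses.SAWTensorRG.RestrictionOfLimit :=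
  stub_restrictionOfLimitOfContinuityOfLimit h

/-! ### The dependency lattice of the sibling cruxes, kernel-checked: 0771 ⇒ 7305 ⇒ 6755 -/

/-- **`ContinuityOfLimit → DiscContinuity` (stmt-7305 ⇒ stmt-6755).** Radó continuity of the scaling limit, stated
over arbitrary parameter domains with injectivity on the closed domain, implies the closed-DISC form `DiscContinuity`
(route SAWExpCovariance), whose uniformizers are only asked to agree with conformal equivalences on the open disc:
Carathéodory supplies the injectivity on the closed disc. [folklore] -/
theorem discContinuity_of_continuityOfLimit
    (hCont : Summit.CriticalPhenomena.SAWScalingLimit.Theses.SAWConePseudogroup.ContinuityOfLimit) :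
    Summit.CriticalPhenomena.SAWScalingLimit.Theses.SAWExpCovariance.DiscContinuity := by
  intro P hch hlim Dn D Φn Φ hΦn hΦ hmk h0 h1 hunif f
  exact tendsto_integral_of_isRadoContinuous_seq (hCont P hch hlim) hΦn hΦ hmk h0 h1 hunif f

/-- **`ConfCovLimit → ContinuityOfLimit` (stmt-0771 ⇒ stmt-7305).** If a conformally covariant scaling limit exists,
every scaling-limit family is Radó-continuous (uniqueness of the scaling limit, then
`IsConformallyCovariant.isRadoContinuous_of_isChordal`). [folklore] -/
theorem continuityOfLimit_of_confCovLimit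
    (hCC : Summit.CriticalPhenomena.SAWScalingLimit.Theses.SAWConfRestriction.ConfCovLimit) :
    Summit.CriticalPhenomena.SAWScalingLimit.Theses.SAWConePseudogroup.ContinuityOfLimit := by
  obtain ⟨P₀, hch₀, hlim₀, hcov₀⟩ := hCC
  intro P hch hlim
  have hP : SAW.IsScalingLimitFamily P := ⟨hch, hlim⟩
  have hP₀ : SAW.IsScalingLimitFamily P₀ := ⟨hch₀, hlim₀⟩
  rw [hP.unique hP₀]
  exact ChordalFamily.IsConformallyCovariant.isRadoContinuous_of_isChordal hcov₀ hch₀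

/-- **`ConfCovLimit → DiscContinuity` (stmt-0771 ⇒ stmt-6755).** [folklore] -/
theorem discContinuity_of_confCovLimit
    (hCC : Summit.CriticalPhenomena.SAWScalingLimit.Theses.SAWConfRestriction.ConfCovLimit) :
    Summit.CriticalPhenomena.SAWScalingLimit.Theses.SAWExpCovariance.DiscContinuity :=
  discContinuity_of_continuityOfLimit (continuityOfLimit_of_confCovLimit hCC)

end Summit.CriticalPhenomena.SAWScalingLimit.Theorems.RestrictionOfLimit.Birth

end
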